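import Summits.FinalStateConjecture.FinalStateConjecture.Theses.RecedingSphereBudgets

/-!
# Route RecedingSphereBudgets — `NullCaptureCone` (item `stmt-FinalStateConjecture-13678`)

The geometric-optics half of the torque filter: a null geodesic of sub-extremal Kerr `(M, a)`,
`|a| < M`, with constants of motion `E > 0`, `L = L_z`, Carter constant `Q ≥ 0` and impact
parameter `|L| / E ≥ 7M` meets a forbidden radius outside the event horizon, i.e. Carter's radial
potential `R(r) = (E(r² + a²) − aL)² − Δ(r)((L − aE)² + Q)`, `Δ = r² − 2Mr + a²`, is nonpositive at
some `r > r₊ = M + √(M² − a²)`.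

Proof: the single witness `r = 4M` works uniformly. Expanding,
`R(4M) = −8M² [(L + 3aE)(L − aE) − 32 E² M²] − (8M² + a²) Q`,
and for `L ≥ 7ME`, `−M < a < M` one has, with `u = L − 7ME ≥ 0`,
`(L + 3aE)(L − aE) − 32E²M² = E²(17M − 3a)(M + a) + uE(7M − a) + uE(7M + 3a) + u² ≥ 0`;
the case `L ≤ −7ME` is the image under `(L, a) ↦ (−L, −a)`. Equality `R(4M) = 0` (with `Q = 0`) is
reached only in the extremal retrograde limit `a → −M`, `L = 7ME`, the classical critical photon
orbit `r = 4M`, `b = 7M` (Bardeen 1973; Chandrasekhar 1983, §63).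
-/

namespace Summit.FinalStateConjecture.FinalStateConjecture.Theorems

open Literature.Geometry.Lorentzian

/-- The algebraic core of `NullCaptureCone`: for `0 < M`, `|a| < M`, `0 < E` and `7ME ≤ |L|`,
`32 E² M² ≤ (L + 3aE)(L − aE)` (so that Carter's `Q = 0` radial potential is `≤ 0` at `r = 4M`).
Equality holds only in the extremal retrograde limit `a = ∓M`, `L = ±7ME`. -/
theorem nullCaptureCone_key {M a E L : ℝ} (hM : 0 < M) (ha : |a| < M) (hE : 0 < E)
    (hL : 7 * M * E ≤ |L|) : 32 * E ^ 2 * M ^ 2 ≤ (L + 3 * a * E) * (L - a * E) := by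
  obtain ⟨ha₁, ha₂⟩ := abs_lt.1 ha
  rcases le_abs.1 hL with h | h
  · -- `L ≥ 7ME`: write `L = 7ME + u`, `u ≥ 0`.
    have hu : 0 ≤ L - 7 * M * E := sub_nonneg.2 h
    have h1 : 0 ≤ E ^ 2 * ((17 * M - 3 * a) * (M + a)) :=
      mul_nonneg (sq_nonneg E) (mul_nonneg (by linarith) (by linarith))
    have h2 : 0 ≤ (L - 7 * M * E) * (E * (7 * M - a)) :=
      mul_nonneg hu (mul_nonneg hE.le (by linarith))
    have h3 : 0 ≤ (L - 7 * M * E) * (E * (7 * M + 3 * a)) :=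
      mul_nonneg hu (mul_nonneg hE.le (by linarith))
    nlinarith [sq_nonneg (L - 7 * M * E), h1, h2, h3]
  · -- `L ≤ −7ME`: the image of the previous case under `(L, a) ↦ (−L, −a)`.
    have hu : 0 ≤ -L - 7 * M * E := by linarith
    have h1 : 0 ≤ E ^ 2 * ((17 * M + 3 * a) * (M - a)) :=
      mul_nonneg (sq_nonneg E) (mul_nonneg (by linarith) (by linarith))
    have h2 : 0 ≤ (-L - 7 * M * E) * (E * (7 * M + a)) :=
      mul_nonneg hu (mul_nonneg hE.le (by linarith))
    have h3 : 0 ≤ (-L - 7 * M * E) * (E * (7 * M - 3 * a)) :=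
      mul_nonneg hu (mul_nonneg hE.le (by linarith))
    nlinarith [sq_nonneg (-L - 7 * M * E), h1, h2, h3]

/-- **`NullCaptureCone` holds** (item `stmt-FinalStateConjecture-13678`, route
`RecedingSphereBudgets`): for sub-extremal Kerr `(M, a)`, `0 < M`, `|a| < M`, and null-geodesic
constants `E > 0`, `L`, `Q ≥ 0` with `7ME ≤ |L|`, there is `r > r₊(M, a)` with
`(E(r² + a²) − aL)² − (r² − 2Mr + a²)((L − aE)² + Q) ≤ 0` — the witness is `r = 4M > 2M ≥ r₊`, where
`R(4M) = −8M²[(L + 3aE)(L − aE) − 32E²M²] − (8M² + a²)Q ≤ 0` by `nullCaptureCone_key`. Hence no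
null geodesic with impact parameter `|b| ≥ 7M` comes in from infinity and crosses `𝓗⁺`
(critical impact parameters satisfy `sup |b_c| = 7M`, approached only at extremality, retrograde,
`r = 4M`; Bardeen 1973, Chandrasekhar 1983 §63). -/
theorem NullCaptureCone_proof :
    Summit.FinalStateConjecture.FinalStateConjecture.Theses.RecedingSphereBudgets.NullCaptureCone := by
  unfold Theses.RecedingSphereBudgets.NullCaptureCone
  intro M a E L Q hM ha hE hQ hL
  refine ⟨4 * M, ?_, ?_⟩
  · -- `r₊ = M + √(M² − a²) ≤ 2M < 4M`
    have h1 : √(M ^ 2 - a ^ 2) ≤ √(M ^ 2) := Real.sqrt_le_sqrt (by nlinarith [sq_nonneg a])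
    rw [Real.sqrt_sq hM.le] at h1
    unfold Kerr.rPlus
    linarith
  · have key := nullCaptureCone_key hM ha hE hL
    have h8 : 0 ≤ 8 * M ^ 2 * ((L + 3 * a * E) * (L - a * E) - 32 * E ^ 2 * M ^ 2) :=
      mul_nonneg (by positivity) (sub_nonneg.2 key)
    have hQ' : 0 ≤ (8 * M ^ 2 + a ^ 2) * Q := mul_nonneg (by positivity) hQ
    have expand : (E * ((4 * M) ^ 2 + a ^ 2) - a * L) ^ 2
        - ((4 * M) ^ 2 - 2 * M * (4 * M) + a ^ 2) * ((L - a * E) ^ 2 + Q)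
        = -(8 * M ^ 2 * ((L + 3 * a * E) * (L - a * E) - 32 * E ^ 2 * M ^ 2))
          - (8 * M ^ 2 + a ^ 2) * Q := by
      ring
    rw [expand]
    linarith

end Summit.FinalStateConjecture.FinalStateConjecture.Theorems
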